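import Summits.CriticalPhenomena.PercolationContinuityZ3.Theorems.PercNearOneGluingNoHeavyQuantSliceSingleLowBudget
import Summits.CriticalPhenomena.PercolationContinuityZ3.Theorems.PercNearOneGluingNoHeavyQuantSliceSingleLowParts
import HarnessLib

/-!
# QUANT lane R8, T-DEC: SLICE CLOSURE FOR SINGLE-LOW LAWS, CASE 1 — the first kernel slice theorem that uses an intermediate layer
# (LEAD-NOTES-G22 N48 (3), routing R*)

builds on p205010 (kernel theorem, internal audit signed; external expert review pending)

Support file (`--supports stmt-CriticalPhenomena-4575`), QUANT lane typer seat prim-quant-stmt (gen 23), rung R8 of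
`run/shared/lean/prim/quant/LADDER.md`.  Theorems only; standard axioms, no sorries.  Lead g22's KERNEL PLAN
(`…QuantSliceTwoRowRates` (p305242) → `…QuantSliceSingleLow`), with `…QuantLowCapacity` (p305864: the capacity inequalities (H_j′), (H_λ)
extracted from DEC data by weak duality), `…QuantSliceSingleLowBudget` (this seat: the `g`-mixture) and `…QuantSliceSingleLowParts`.

* **`slice_flowAtT_singleLow_case1`** — law `ν ≥ 0` on `{0..M}`, target `T`, floor `0 < x < 1`, layer `j′ ≤ M`, blob `(a ≥ 1,
  x ≤ g ≤ 1)`, `T′ = T + ag`; `l` the ONLY low at `(T, j′)`, DEEP (`2(l+a) < T′`), `l + a ≤ j′`; a layer parameter `λ` with `j′ ≤ λ + a` and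
  no band atom of `ν` above `λ`; the capacity inequalities (H_j′) `(x/(1−x))ν l ≤ Σ capCoef·ν` and (H_λ) `(x/(1−x))ν l ≤ Σ_{λ<h≤M} ν h`;
  CASE 1 `Σ_h A_h ≤ g·ν l` (`A_h = (1−g)ν h/usage x T′ j′ (l+a) h` over the compatible mids `h ≤ j′` of `l`).  THEN
  `FlowAtT x T′ j′ (M+a) (slice ν a g)` — the slice is DEC(j′) at the raised target in the flow form (`decAtT_of_flowAtT` converts).
  WITNESS = routing R*: band verticals `w ↦ w + a` (self-financing); the row-1 copy `l + a` saturates the row-0 copy of every compatible mid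
  through the anti-diagonal pairs (cheaper: `usage_antiDiag_le`) and sends its remainder, with the whole row-0 copy of `l`, to the giant
  parts `(1−g)ν h` (`h > j′`) and `g·ν(h−a)` (`h − a > λ`) proportionally; the giant columns close by `singleLow_giant_budget`
  (`g·(H_λ) + (1−g)·(H_j′)`), band copies and row-1 parts never collide because no band atom lies above `λ`.
With `λ = λ*` (least true window mid − 1) the hypotheses are N48 (1)'s geometry (`band_lt_straddler`, `band_deep_incompatible`); Case 2
(`Σ A_h > g·ν l`) remains (N48 (3): `g ≥ 1/2` by (H_λ*), `g < 1/2` needs the leftover term).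

[this work]; `…QuantLawDecFlows` (typer g22: `FlowAtT`), this seat's `…QuantFlowUncross` (`usage_pos_of_compat`).  Nothing here is cited as
a published result.  The gluing rows served [cite: KozmaNitzan2024, Conjecture 3 (p. 15)]; product measure [cite: Grimmett1999, §1.3 p. 10].
-/

noncomputable section

namespace Summit.CriticalPhenomena.PercolationContinuityZ3.Theorems

namespace Quant

open Finset

namespace LawDec

/-! ### The single-low slice theorem, Case 1 -/

set_option maxHeartbeats 1600000 in
/-- **SL FOR SINGLE-LOW LAWS, CASE 1** (lead g22 N48 (3), routing R*).  Law `ν ≥ 0` on `{0..M}`; target `T`, floor `0 < x < 1`,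
layer `j′ ≤ M`; blob `(a ≥ 1, x ≤ g ≤ 1)`, raised target `T′ = T + ag`.  Hypotheses: `l` is the ONLY low of `ν` at `(T, j′)`
(`2l < T`, every other `k ≤ j′` with `2k < T` has `ν k = 0`), it is DEEP (`2(l+a) < T′`) and its copy stays below the layer
(`l + a ≤ j′`); a second layer parameter `λ` with `j′ ≤ λ + a` (the copies of the atoms above `λ` are giants of the slice) above which `ν`
has NO BAND atom (`λ < h ≤ j′`, `ν h > 0` ⟹ `T′ ≤ 2h`); the two capacity inequalities (H_j′) `(x/(1−x))ν l ≤ Σ capCoef·ν`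
(`low_capacity_of_decAtT` from DEC(j′)) and (H_λ) `(x/(1−x))ν l ≤ Σ_{λ<h≤M} ν h` (`low_giantCapacity_of_decAtT` from DEC(λ)); and
CASE 1: the anti-diagonal capacities fit into the row-1 copy of `l`: `Σ_h A_h ≤ g·ν l`, `A_h = (1−g)ν h / usage x T′ j′ (l+a) h` over
the compatible mids `h ≤ j′` of `l`.  CONCLUSION: `FlowAtT x T′ j′ (M+a) (slice ν a g)`.  WITNESS (routing R*): every band position
`p` ships `(1−g)ν p` vertically to `p + a` (self-financing); the copy `l + a` ships `A_h` anti-diagonally to the row-0 copy of each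
compatible mid `h` (saturating it) and its remainder `g·ν l − Σ A`, together with the whole row-0 copy `(1−g)ν l` of `l`, to the giant
parts `(1−g)ν h` (`h > j′`) and `g·ν(h−a)` (`h − a > λ`) proportionally; the giant budget is `singleLow_giant_budget`. [this work] -/
theorem slice_flowAtT_singleLow_case1 (x T g : ℝ) (j' M l a lam : ℕ) (ν : ℕ → ℝ) (hx0 : 0 < x) (hx1 : x < 1) (hxg : x ≤ g)
    (hg1 : g ≤ 1) (ha : 1 ≤ a) (hν : ∀ k, 0 ≤ ν k) (hνM : ∀ k, M < k → ν k = 0) (hjM : j' ≤ M)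
    (hlaj : l + a ≤ j') (hlow : 2 * (l : ℝ) < T) (hdeep : 2 * ((l : ℝ) + a) < T + (a : ℝ) * g)
    (hsingle : ∀ k, k ≤ j' → 2 * (k : ℝ) < T → k ≠ l → ν k = 0)
    (hlam : j' ≤ lam + a) (hnoband : ∀ h, lam < h → h ≤ j' → 0 < ν h → T + (a : ℝ) * g ≤ 2 * (h : ℝ))
    (hCj : x / (1 - x) * ν l ≤ ∑ h ∈ Finset.range (M + 1), capCoef x T j' l h * ν h)
    (hClam : x / (1 - x) * ν l ≤ ∑ h ∈ Finset.Ico (lam + 1) (M + 1), ν h)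
    (hcase1 : ∑ h ∈ Finset.range (M + a + 1),
        (if h ≤ j' ∧ T ≤ 2 * (h : ℝ) ∧ T < (l : ℝ) + h then (1 - g) * ν h / usage x (T + (a : ℝ) * g) j' (l + a) h else 0)
      ≤ g * ν l) :
    FlowAtT x (T + (a : ℝ) * g) j' (M + a) (slice ν a g) := by
  have h1x : 0 < 1 - x := by linarith
  have hxr : 0 < x / (1 - x) := div_pos hx0 h1x
  have hg0 : 0 ≤ g := hx0.le.trans hxg
  have h1g : 0 ≤ 1 - g := by linarith
  have hlj : l ≤ j' := by omega
  have hag : (a : ℝ) * g ≤ a := by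
    have := mul_le_mul_of_nonneg_left hg1 (Nat.cast_nonneg a); linarith
  -- names for the pieces: band mass c, anti-diagonal amounts A, giant parts P, their totals SA, C
  obtain ⟨c, hc⟩ : ∃ c : ℕ → ℝ, c = fun p =>
      (if p ≤ j' ∧ 2 * (p : ℝ) < T + (a : ℝ) * g ∧ T ≤ 2 * (p : ℝ) then (1 - g) * ν p else 0) := ⟨_, rfl⟩
  obtain ⟨A, hA⟩ : ∃ A : ℕ → ℝ, A = fun h =>
      (if h ≤ j' ∧ T ≤ 2 * (h : ℝ) ∧ T < (l : ℝ) + h then (1 - g) * ν h / usage x (T + (a : ℝ) * g) j' (l + a) h else 0) :=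
    ⟨_, rfl⟩
  obtain ⟨P, hP⟩ : ∃ P : ℕ → ℝ, P = fun h =>
      (1 - g) * (if j' + 1 ≤ h then ν h else 0) + g * (if a ≤ h ∧ lam + 1 ≤ h - a then ν (h - a) else 0) := ⟨_, rfl⟩
  obtain ⟨SA, hSA⟩ : ∃ SA : ℝ, SA = ∑ h ∈ Finset.range (M + a + 1), A h := ⟨_, rfl⟩
  obtain ⟨C, hC⟩ : ∃ C : ℝ, C = ∑ h ∈ Finset.range (M + a + 1), P h := ⟨_, rfl⟩
  have hcase1' : SA ≤ g * ν l := by rw [hSA, hA]; exact hcase1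
  -- basic facts on the pieces
  have hcval : ∀ p, c p = (if p ≤ j' ∧ 2 * (p : ℝ) < T + (a : ℝ) * g ∧ T ≤ 2 * (p : ℝ) then (1 - g) * ν p else 0) :=
    fun p => by rw [hc]
  have hAval : ∀ h, A h = (if h ≤ j' ∧ T ≤ 2 * (h : ℝ) ∧ T < (l : ℝ) + h
      then (1 - g) * ν h / usage x (T + (a : ℝ) * g) j' (l + a) h else 0) := fun h => by rw [hA]
  have hPval : ∀ h, P h = (1 - g) * (if j' + 1 ≤ h then ν h else 0)
      + g * (if a ≤ h ∧ lam + 1 ≤ h - a then ν (h - a) else 0) := fun h => by rw [hP]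
  have hcpos : ∀ p, 0 ≤ c p := by
    intro p; rw [hcval]; split_ifs
    · exact mul_nonneg h1g (hν p)
    · exact le_rfl
  have huad : ∀ h : ℕ, T < (l : ℝ) + (h : ℝ) → 0 < usage x (T + (a : ℝ) * g) j' (l + a) h := by
    intro h hch
    have hmid := deep_straddler_two_mul_gt T g l h a hg1 hdeep hch
    have hlam' : l + a < h := deep_lt_mid T g l h a hdeep hmid.le
    have hlow' : 2 * (((l + a : ℕ) : ℝ)) < T + (a : ℝ) * g := by push_cast; exact hdeep
    exact usage_pos_of_compat x (T + (a : ℝ) * g) j' (l + a) h hx0 hx1 hlow' hlam'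
      (Or.inr (antiDiag_compatible T g l h a hg1 hch))
  have hApos : ∀ h, 0 ≤ A h := by
    intro h; rw [hAval]
    split_ifs with hch
    · exact div_nonneg (mul_nonneg h1g (hν h)) (huad h hch.2.2).le
    · exact le_rfl
  have hPpos : ∀ h, 0 ≤ P h := by
    intro h; rw [hPval]
    have := hν h; have := hν (h - a)
    refine add_nonneg (mul_nonneg h1g ?_) (mul_nonneg hg0 ?_) <;> split_ifs <;> linarith
  have hPsupp : ∀ h, P h ≠ 0 → j' + 1 ≤ h ∧ h ≤ M + a := by
    intro h hne; rw [hPval] at hne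
    by_contra hn
    apply hne
    have hz1 : (if j' + 1 ≤ h then ν h else 0) = 0 := by
      split_ifs with h1
      · exact hνM h (by omega)
      · rfl
    have hz2 : (if a ≤ h ∧ lam + 1 ≤ h - a then ν (h - a) else 0) = 0 := by
      split_ifs with h2
      · exact hνM (h - a) (by omega)
      · rfl
    rw [hz1, hz2]; ring
  have hSA0 : 0 ≤ SA := by rw [hSA]; exact Finset.sum_nonneg (fun h _ => hApos h)
  have hC0 : 0 ≤ C := by rw [hC]; exact Finset.sum_nonneg (fun h _ => hPpos h)
  have hPleC : ∀ h, P h ≤ C := by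
    intro h
    by_cases hm : h ∈ Finset.range (M + a + 1)
    · rw [hC]; exact Finset.single_le_sum (f := P) (fun k _ => hPpos k) hm
    · have : P h = 0 := by
        by_contra hne; have := (hPsupp h hne).2; exact hm (Finset.mem_range.2 (by omega))
      rw [this]; exact hC0
  -- the giant budget: x/(1−x)·(ν l − SA) ≤ C
  have hCeq : C = (1 - g) * ∑ h ∈ Finset.Ico (j' + 1) (M + 1), ν h + g * ∑ k ∈ Finset.Ico (lam + 1) (M + 1), ν k := by
    rw [hC, hP]; exact sum_giantParts ν g j' M a lam hνM
  have hSAeq : SA = ∑ h ∈ Finset.range (M + 1),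
      (if h ≤ j' ∧ T ≤ 2 * (h : ℝ) ∧ T < (l : ℝ) + h then (1 - g) * ν h / usage x (T + (a : ℝ) * g) j' (l + a) h else 0) := by
    rw [hSA, hA]
    have e : ∀ h, (if h ≤ j' ∧ T ≤ 2 * (h : ℝ) ∧ T < (l : ℝ) + h
          then (1 - g) * ν h / usage x (T + (a : ℝ) * g) j' (l + a) h else 0)
        = (if h ≤ j' ∧ T ≤ 2 * (h : ℝ) ∧ T < (l : ℝ) + h
          then ((1 - g) / usage x (T + (a : ℝ) * g) j' (l + a) h) * ν h else 0) := by
      intro h; split_ifs <;> ring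
    simp only [e]
    exact sum_range_extend_ite ν M a hνM _ _
  have hbudget : x / (1 - x) * (ν l - SA) ≤ C := by
    rw [hCeq, hSAeq]
    exact singleLow_giant_budget x T g j' M l a lam ν hx0 hx1 hg0 hg1 hν hlow hdeep hCj hClam
  have hνl := hν l
  have hR0 : 0 ≤ ν l - SA := by nlinarith
  -- the giant coefficient of the two copies of l, and its total
  have hcoefC : ∀ p, ((if p = l then (1 - g) * ν l else 0) + (if p = l + a then g * ν l - SA else 0)) * C / C
      = (if p = l then (1 - g) * ν l else 0) + (if p = l + a then g * ν l - SA else 0) := by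
    intro p
    by_cases hC0' : C = 0
    · -- no giant part: the budget forces both copies of l to vanish
      have hR : ν l - SA = 0 := by
        have : x / (1 - x) * (ν l - SA) ≤ 0 := by rw [← hC0']; exact hbudget
        nlinarith
      have h0a : (1 - g) * ν l = 0 := by nlinarith
      have h0b : g * ν l - SA = 0 := by nlinarith
      rw [hC0', h0a, h0b]; simp
    · field_simp
  -- THE WITNESS
  refine ⟨fun p h => c p * (if h = p + a then (1:ℝ) else 0) + (if p = l + a then A h else 0)
      + ((if p = l then (1 - g) * ν l else 0) + (if p = l + a then g * ν l - SA else 0)) * P h / C, ?_, ?_, ?_, ?_⟩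
  · -- nonnegativity
    intro p h
    have hi : 0 ≤ (if h = p + a then (1:ℝ) else 0) := by split_ifs <;> norm_num
    have hd : 0 ≤ (if p = l + a then A h else 0) := by
      split_ifs
      · exact hApos h
      · exact le_rfl
    have hco : 0 ≤ (if p = l then (1 - g) * ν l else 0) + (if p = l + a then g * ν l - SA else 0) := by
      refine add_nonneg ?_ ?_
      · split_ifs
        · exact mul_nonneg h1g hνl
        · exact le_rfl
      · split_ifs
        · linarith
        · exact le_rfl
    have := hPpos h
    have := hcpos p
    have : 0 ≤ ((if p = l then (1 - g) * ν l else 0) + (if p = l + a then g * ν l - SA else 0)) * P h / C :=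
      div_nonneg (mul_nonneg hco (hPpos h)) hC0
    positivity
  · -- support: each piece, when positive, sits on an admissible pair
    intro p h hpos
    dsimp only at hpos
    have hT' : T + (a : ℝ) * g ≤ T + a := by linarith
    by_cases h1 : c p * (if h = p + a then (1:ℝ) else 0) ≠ 0
    · -- band vertical
      have hcp : c p ≠ 0 := fun hz => h1 (by rw [hz, zero_mul])
      have hh : h = p + a := by by_contra hn; exact h1 (by rw [if_neg hn, mul_zero])
      rw [hcval] at hcp
      have hcond : p ≤ j' ∧ 2 * (p : ℝ) < T + (a : ℝ) * g ∧ T ≤ 2 * (p : ℝ) := by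
        by_contra hn; exact hcp (by rw [if_neg hn])
      rw [if_pos hcond] at hcp
      have hνp : ν p ≠ 0 := fun hz => hcp (by rw [hz, mul_zero])
      have hg1' : g < 1 := by
        by_contra hn; push Not at hn
        exact hcp (by rw [le_antisymm hg1 hn, sub_self, zero_mul])
      have hpM : p ≤ M := by by_contra hn; exact hνp (hνM p (by omega))
      refine ⟨hcond.1, hcond.2.1, by omega, Or.inr ?_⟩
      rw [hh]; push_cast
      have : (a : ℝ) * g < a := by
        have ha' : (0:ℝ) < a := by exact_mod_cast (lt_of_lt_of_le Nat.zero_lt_one ha)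
        nlinarith
      linarith [hcond.2.2]
    · push Not at h1
      rw [h1, zero_add] at hpos
      by_cases h2 : (if p = l + a then A h else 0) ≠ 0
      · -- anti-diagonal
        have hp : p = l + a := by by_contra hn; exact h2 (by rw [if_neg hn])
        rw [if_pos hp, hAval] at h2
        have hcond : h ≤ j' ∧ T ≤ 2 * (h : ℝ) ∧ T < (l : ℝ) + h := by by_contra hn; exact h2 (by rw [if_neg hn])
        rw [if_pos hcond] at h2
        have hνh : ν h ≠ 0 := fun hz => h2 (by rw [hz, mul_zero, zero_div])
        have hhM : h ≤ M := by by_contra hn; exact hνh (hνM h (by omega))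
        rw [hp]
        refine ⟨hlaj, by push_cast; exact hdeep, by omega, Or.inr (antiDiag_compatible T g l h a hg1 hcond.2.2)⟩
      · -- giant split
        push Not at h2
        rw [h2, zero_add] at hpos
        have hPh : P h ≠ 0 := by
          intro hz; rw [hz, mul_zero, zero_div] at hpos; exact lt_irrefl _ hpos
        obtain ⟨hgi, hhM⟩ := hPsupp h hPh
        have hp : p = l ∨ p = l + a := by
          by_contra hn; push Not at hn
          rw [if_neg hn.1, if_neg hn.2, zero_add, zero_mul, zero_div] at hpos; exact lt_irrefl _ hpos
        rcases hp with hp | hp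
        · rw [hp]; exact ⟨hlj, by linarith, hhM, Or.inl hgi⟩
        · rw [hp]; exact ⟨hlaj, by push_cast; exact hdeep, hhM, Or.inl hgi⟩
  · -- rows
    intro p hpj hplow
    dsimp only
    have hpM : p + a ∈ Finset.range (M + a + 1) := Finset.mem_range.2 (by omega)
    rw [Finset.sum_add_distrib, Finset.sum_add_distrib, ← Finset.mul_sum,
      Finset.sum_ite_eq' (Finset.range (M + a + 1)) (p + a) (fun _ => (1:ℝ)), if_pos hpM, mul_one,
      ← Finset.sum_div, ← Finset.mul_sum, ← hC, hcoefC p]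
    have hsA : ∑ h ∈ Finset.range (M + a + 1), (if p = l + a then A h else 0) = (if p = l + a then SA else 0) := by
      by_cases hpl : p = l + a
      · simp only [if_pos hpl]; rw [hSA]
      · simp only [if_neg hpl, Finset.sum_const_zero]
    rw [hsA, slice_lowRow_of_singleLow T g j' l a ν hg1 ha hlow hsingle p hpj hplow, hcval]
    have hband : (if p ≤ j' ∧ 2 * (p : ℝ) < T + (a : ℝ) * g ∧ T ≤ 2 * (p : ℝ) then (1 - g) * ν p else 0)
        = (if T ≤ 2 * (p : ℝ) then (1 - g) * ν p else 0) := by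
      by_cases hb : T ≤ 2 * (p : ℝ)
      · rw [if_pos ⟨hpj, hplow, hb⟩, if_pos hb]
      · rw [if_neg (fun h => hb h.2.2), if_neg hb]
    rw [hband]
    by_cases h1 : p = l + a
    · by_cases h2 : p = l
      · simp only [if_pos h1, if_pos h2]; ring
      · simp only [if_pos h1, if_neg h2]; ring
    · by_cases h2 : p = l
      · simp only [if_neg h1, if_pos h2]; ring
      · simp only [if_neg h1, if_neg h2]; ring
  · -- columns
    intro h hhM hself
    dsimp only
    have e : ∀ p, usage x (T + (a : ℝ) * g) j' p h * (c p * (if h = p + a then (1:ℝ) else 0)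
          + (if p = l + a then A h else 0)
          + ((if p = l then (1 - g) * ν l else 0) + (if p = l + a then g * ν l - SA else 0)) * P h / C)
        = (usage x (T + (a : ℝ) * g) j' p h * c p) * (if h = p + a then (1:ℝ) else 0)
          + usage x (T + (a : ℝ) * g) j' p h * (if p = l + a then A h else 0)
          + (usage x (T + (a : ℝ) * g) j' p h
              * ((if p = l then (1 - g) * ν l else 0) + (if p = l + a then g * ν l - SA else 0))) * (P h / C) := by
      intro p; ring
    simp only [e, Finset.sum_add_distrib, ← Finset.sum_mul]
    have hlr : l ∈ Finset.range (j' + 1) := Finset.mem_range.2 (by omega)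
    have hlar : l + a ∈ Finset.range (j' + 1) := Finset.mem_range.2 (by omega)
    -- TERM 1 (band verticals): only p = h − a contributes, and it is self-financing
    have hband : ∀ w, c w ≠ 0 → w ≤ j' ∧ 2 * (w : ℝ) < T + (a : ℝ) * g ∧ T ≤ 2 * (w : ℝ) ∧ 0 < ν w := by
      intro w hw
      rw [hcval] at hw
      by_cases hcw : w ≤ j' ∧ 2 * (w : ℝ) < T + (a : ℝ) * g ∧ T ≤ 2 * (w : ℝ)
      · refine ⟨hcw.1, hcw.2.1, hcw.2.2, lt_of_le_of_ne (hν w) ?_⟩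
        intro hz; rw [if_pos hcw, ← hz, mul_zero] at hw; exact hw rfl
      · rw [if_neg hcw] at hw; exact absurd rfl hw
    have hT1 : ∑ p ∈ Finset.range (j' + 1), (usage x (T + (a : ℝ) * g) j' p h * c p) * (if h = p + a then (1:ℝ) else 0)
        ≤ g * (if a ≤ h then ν (h - a) else 0)
        ∧ (∑ p ∈ Finset.range (j' + 1), (usage x (T + (a : ℝ) * g) j' p h * c p) * (if h = p + a then (1:ℝ) else 0) ≠ 0
            → a ≤ h ∧ c (h - a) ≠ 0) := by
      by_cases hah : a ≤ h ∧ h - a ≤ j'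
      · have hsum : ∑ p ∈ Finset.range (j' + 1), (usage x (T + (a : ℝ) * g) j' p h * c p) * (if h = p + a then (1:ℝ) else 0)
            = usage x (T + (a : ℝ) * g) j' (h - a) h * c (h - a) := by
          rw [Finset.sum_eq_single (h - a)]
          · rw [if_pos (by omega), mul_one]
          · intro p _ hne; rw [if_neg (by omega), mul_zero]
          · intro hn; exact absurd (Finset.mem_range.2 (by omega)) hn
        rw [hsum, if_pos hah.1]
        refine ⟨?_, fun hne => ⟨hah.1, fun hz => hne (by rw [hz, mul_zero])⟩⟩
        by_cases hcw : c (h - a) = 0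
        · rw [hcw, mul_zero]; exact mul_nonneg hg0 (hν _)
        · obtain ⟨-, -, hTw, -⟩ := hband (h - a) hcw
          rw [hcval, if_pos ⟨hah.2, (hband (h - a) hcw).2.1, hTw⟩]
          have hwa : h - a + a = h := by omega
          have := band_usage_le x T g j' (h - a) a (ν (h - a)) (hν _) hx0 hxg hg1 ha hTw
          rw [hwa] at this
          exact this
      · have hsum : ∑ p ∈ Finset.range (j' + 1), (usage x (T + (a : ℝ) * g) j' p h * c p) * (if h = p + a then (1:ℝ) else 0)
            = 0 := by
          refine Finset.sum_eq_zero (fun p hp => ?_)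
          have hpj : p ≤ j' := Nat.lt_succ_iff.1 (Finset.mem_range.1 hp)
          rw [if_neg (by omega), mul_zero]
        rw [hsum]
        exact ⟨mul_nonneg hg0 (by split_ifs <;> linarith [hν (h - a)]), fun hne => absurd rfl hne⟩
    -- TERM 2 (anti-diagonals): only p = l + a contributes, and it saturates the row-0 copy at most
    have hT2 : ∑ p ∈ Finset.range (j' + 1), usage x (T + (a : ℝ) * g) j' p h * (if p = l + a then A h else 0)
        ≤ (1 - g) * ν h := by
      rw [Finset.sum_eq_single (l + a)]
      · rw [if_pos rfl, hAval]
        by_cases hch : h ≤ j' ∧ T ≤ 2 * (h : ℝ) ∧ T < (l : ℝ) + h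
        · rw [if_pos hch, mul_div_assoc', mul_comm, mul_div_assoc, div_self (huad h hch.2.2).ne', mul_one]
        · rw [if_neg hch, mul_zero]; exact mul_nonneg h1g (hν h)
      · intro p _ hne; rw [if_neg hne, mul_zero]
      · intro hn; exact absurd hlar hn
    -- TERM 3 (giant split): bounded by the giant part P h
    have hT3 : (∑ p ∈ Finset.range (j' + 1), usage x (T + (a : ℝ) * g) j' p h
          * ((if p = l then (1 - g) * ν l else 0) + (if p = l + a then g * ν l - SA else 0))) * (P h / C) ≤ P h := by
      by_cases hPh : P h = 0
      · rw [hPh, zero_div, mul_zero]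
      · obtain ⟨hgi, -⟩ := hPsupp h hPh
        have hsum : ∑ p ∈ Finset.range (j' + 1), usage x (T + (a : ℝ) * g) j' p h
            * ((if p = l then (1 - g) * ν l else 0) + (if p = l + a then g * ν l - SA else 0))
            = x / (1 - x) * (ν l - SA) := by
          rw [Finset.sum_congr rfl (fun p _ => by rw [usage_giant_eq x (T + (a : ℝ) * g) j' p h hgi]), ← Finset.mul_sum,
            Finset.sum_add_distrib, Finset.sum_ite_eq' (Finset.range (j' + 1)) l, Finset.sum_ite_eq' (Finset.range (j' + 1)) (l + a),
            if_pos hlr, if_pos hlar]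
          ring
        rw [hsum]
        have hCpos : 0 < C := lt_of_lt_of_le (lt_of_le_of_ne (hPpos h) (Ne.symm hPh)) (hPleC h)
        calc x / (1 - x) * (ν l - SA) * (P h / C) ≤ C * (P h / C) :=
              mul_le_mul_of_nonneg_right hbudget (div_nonneg (hPpos h) hC0)
          _ = P h := by field_simp
    -- assemble
    show _ ≤ slice ν a g h
    simp only [slice]
    by_cases hPh : P h = 0
    · -- no giant part here: a mid of the slice (or an empty giant)
      have h3 : (∑ p ∈ Finset.range (j' + 1), usage x (T + (a : ℝ) * g) j' p h
          * ((if p = l then (1 - g) * ν l else 0) + (if p = l + a then g * ν l - SA else 0))) * (P h / C) = 0 := by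
        rw [hPh, zero_div, mul_zero]
      rw [h3, add_zero]
      linarith [hT1.1, hT2]
    · -- a giant carrying a part: the anti-diagonal term vanishes, band and split parts are disjoint
      obtain ⟨hgi, -⟩ := hPsupp h hPh
      have h2 : ∑ p ∈ Finset.range (j' + 1), usage x (T + (a : ℝ) * g) j' p h * (if p = l + a then A h else 0) = 0 := by
        refine Finset.sum_eq_zero (fun p _ => ?_)
        by_cases hp : p = l + a
        · rw [if_pos hp, hAval, if_neg (by intro hc; omega), mul_zero]
        · rw [if_neg hp, mul_zero]
      rw [h2, add_zero]
      have hPh' : P h = (1 - g) * ν h + g * (if a ≤ h ∧ lam + 1 ≤ h - a then ν (h - a) else 0) := by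
        rw [hPval, if_pos hgi]
      by_cases hT1z : ∑ p ∈ Finset.range (j' + 1), (usage x (T + (a : ℝ) * g) j' p h * c p)
          * (if h = p + a then (1:ℝ) else 0) = 0
      · rw [hT1z, zero_add]
        refine hT3.trans ?_
        rw [hPh']
        have : (if a ≤ h ∧ lam + 1 ≤ h - a then ν (h - a) else 0) ≤ (if a ≤ h then ν (h - a) else 0) := by
          split_ifs with h1 h2 <;> first | exact le_rfl | exact hν _ | exact absurd h1.1 h2
        nlinarith [this]
      · -- the band at h − a is charged, hence h − a ≤ λ: the row-1 part of P h is absent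
        obtain ⟨hah, hcw⟩ := hT1.2 hT1z
        obtain ⟨hwj, hwlow, -, hνw⟩ := hband (h - a) hcw
        have hnl : ¬ (a ≤ h ∧ lam + 1 ≤ h - a) := by
          rintro ⟨-, hlw⟩
          have := hnoband (h - a) (by omega) hwj hνw
          linarith
        rw [hPh', if_neg hnl, mul_zero, add_zero] at hT3 ⊢
        have hT1' := hT1.1
        rw [if_pos hah] at hT1'
        rw [if_pos hah]
        linarith

end LawDec

end Quant

end Summit.CriticalPhenomena.PercolationContinuityZ3.Theorems
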